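import Summits.RiemannHypothesis.RiemannHypothesis.Theorems.Splittings.BombieriTruncScreenAbove
import HarnessLib

/-!
# Splittings — x-wuc GEN-8 (xiv-f) 2/5: MASS-AWARE SAMPLING (the typed ζ-free target), T8b normalised screening, T8c screening
# at level one from a HELPER BAND

Cell rh-split, seat rh-split-x-wuc g8 (brief sha16 f79c5f09d8bcb036), card `run/shared/lean/pub/rh-split/cards/SPLIT-x-wuc.md` §14.
CARVE NOTE (lane (xiv-f), lead RULING #113): part 2/5 of the VERBATIM carve of §G8.4–§G8.12 of the FROZEN scratch
`HOME/rh-split-x-wuc/SplitXWucG8.lean` sha16 72896d9b60505e56 (rider 5 FINAL; ref g6 REPLAY PASS 13:08:54Z), source lines l.559–900, by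
rh-split-typer-3 g0; RE-OPENS the namespace `…Splittings.BombieriTruncMassAware` of the landed §G8.1–§G8.3 (FQNs do not move); `#print axioms`
guards not carried; untagged parameterised `def … : Prop` hypotheses (`LocBand`, `HelperBand`) kept VERBATIM (HANDOFF-g8: typer's discretion).

* G8.5 `Phi`, the local band predicate `LocBand` (data arguments) and the ONE residual ζ-free conjecture `MassAwareSampling δ θ`
  (`@[conjecture] def`, level ONE; UNPROVED at any useful constant); * G8.6 (T8b) `hwt`/`hmul`/`ampOn`/`ampOff`, `synth_negRoot_normalised`;
* G8.7 (T8c) `zdens`, `hkap`, the counting hypothesis `HelperBand T₀ δ` (untagged parameterised `def : Prop`, DISCHARGED in part 3) and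
  `offLineScreenedAboveAt_of_helperBand`. LABEL (referee g6): `MassAwareSampling` = the ONE ζ-free residual conjecture (cell-coined, NOT in
  print — bookkeeping); T8b/T8c RH-free; certifies nothing about RH.
HONEST LABEL: «SPLITTING SEARCH over kernel-typed RH-EQUIVALENCES; a splitting A ∧ B ⟹ RH is CONDITIONAL bookkeeping
unless A and B are both proved; nothing here bears on the truth of RH.»
-/

set_option linter.dupNamespace false

noncomputable section

open scoped Classical ComplexConjugate
open Set Filter Topology Complex MeasureTheory

namespace Summit.RiemannHypothesis.RiemannHypothesis.Theorems.Splittings.BombieriTruncMassAware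

open Literature.NumberTheory.LFunctions Literature.NumberTheory.LFunctions.Bombieri2000
open Summit.RiemannHypothesis.RiemannHypothesis.Theses.RuelleBand
open Summit.RiemannHypothesis.RiemannHypothesis.Theorems.Splittings.BombieriTruncEigen
open Summit.RiemannHypothesis.RiemannHypothesis.Theorems.Splittings.BombieriFozNoDep
open Summit.RiemannHypothesis.RiemannHypothesis.Theorems.Splittings.BombieriTruncGram
open Summit.RiemannHypothesis.RiemannHypothesis.Theorems.Splittings.BombieriTruncPairing
open Summit.RiemannHypothesis.RiemannHypothesis.Theorems.Splittings.BombieriTruncScreening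
open Summit.RiemannHypothesis.RiemannHypothesis.Theorems.Splittings.BombieriTruncBandGap
open Summit.RiemannHypothesis.RiemannHypothesis.Theorems.Splittings.BombieriTruncMultiplicity
open Summit.RiemannHypothesis.RiemannHypothesis.Theorems.Splittings.BombieriTruncEventualStrip
open Summit.RiemannHypothesis.RiemannHypothesis.Theorems.Splittings.BombieriTruncExactness
open Summit.RiemannHypothesis.RiemannHypothesis.Theorems.Splittings.BombieriTruncClump
open Summit.RiemannHypothesis.RiemannHypothesis.Theorems.Splittings.BombieriTruncOffLineSparse
open Summit.RiemannHypothesis.RiemannHypothesis.Theorems.Splittings.BombieriTruncSynthesis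
open Summit.RiemannHypothesis.RiemannHypothesis.Theorems.Splittings.BombieriTruncSynthesisScreening
open Summit.RiemannHypothesis.RiemannHypothesis.Theorems.Splittings.BombieriTruncSynthesisRows
open Literature.NumberTheory.DiophantineGeometry (RiemannHypothesisUpTo)

variable {N : ℕ}

/-! ### G8.5 The typed ζ-free analytic input: MASS-AWARE SAMPLING (UNPROVED target; see card §14b–e for the constants) -/

/-- `Φ(κ) = ∫_{−1}^{1} (2 sinh κu)² du = 4·(sinh(2κ)/(2κ) − 1)` — the energy of the off-line profile (`Φ ≤ Φ(½) = 0.7008…`). -/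
def Phi (κ : ℝ) : ℝ := 4 * (Real.sinh (2 * κ) / (2 * κ) - 1)

/-- LOCAL BAND of a weighted configuration `(λ_k, w_k)` plus a virtual atom of mass `w₀` at `0`, against the flat density `D` at relative
width `δ`, on the subintervals of `[−Λ, Λ]` of LENGTH AT MOST `4` (> π: the band then bounds every gap by `δ`; longer intervals follow by
additivity with linearly growing error, which local frame theory tolerates and which the zeros of `ζ` need — density drift). -/
def LocBand (δ D Λ : ℝ) {n : ℕ} (lam w : Fin n → ℝ) (w₀ : ℝ) : Prop :=
  ∀ a b : ℝ, -Λ ≤ a → a < b → b ≤ Λ → b - a ≤ 4 →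
    |(∑ k ∈ Finset.univ.filter (fun k ↦ a < lam k ∧ lam k ≤ b), w k) +
        (if a < 0 ∧ 0 ≤ b then w₀ else 0) - D * (b - a)| ≤ δ * D

/-- **MASS-AWARE SAMPLING at displacement `δ` with constant `θ`** (ζ-free; typed TARGET, unproved at any useful constant; LEVEL-ONE, LOCAL,
CAPPED form — card §14h).  For every relative tolerance `ε`, decay `κ₀ ∈ (0, ½)` and density `D ≥ 1` there is a spectral range
`Λ ≤ e^{2πD}/4` (the cap is what the zeros of `ζ` at density `D`, i.e. height `T = 2π e^{2πD}`, can supply with flat density: `Λ ≤ T/8π`)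
such that: whenever finitely many frequencies `λ_k` with masses `w_k > 0` and multipliers `κ_k ∈ [0, ½)`, TOGETHER WITH a virtual atom of
mass `w₀ ≤ δ·D` at `λ = 0` (the target's own class pair), satisfy the LOCAL band `LocBand δ D Λ`, the profile `2 sinh(κ₀u)` on `[−1,1]` is
synthesised from the `cosh`-modulated exponentials with `cost + Σ_k |b_k|²/w_k ≤ (1+ε)·Φ(κ₀)/(2πθD)` (ridge level `1`; by the covariance
`(w, c) ↦ (Dw, Dc)` this is level `1/D` at unit-normalised masses).  Feeds `OffLineScreenedAboveAt T₀ 1` through T8b/T8c as soon as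
`δ·Φ < 8πθ` on `(0, ½)`, i.e. `θ > δ·Φ(½)/8π = C₁_eff·Φ(½)/2` with `δ = 4π C₁_eff` (card §14b).  Toy evidence (card §14e, all-lengths band,
levels `c ∈ [10⁻³, 1]`): `θ_adv(1.27) ≈ 0.53–0.56`, `θ_adv(3.0) ≈ 0.12–0.13`. [new; conjectural] -/
@[conjecture] def MassAwareSampling (δ θ : ℝ) : Prop :=
  ∀ ε : ℝ, 0 < ε → ∀ κ₀ : ℝ, 0 < κ₀ → κ₀ < 1 / 2 → ∀ D : ℝ, 1 ≤ D →
    ∃ Λ : ℝ, 0 < Λ ∧ Λ ≤ Real.exp (2 * Real.pi * D) / 4 ∧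
      ∀ (n : ℕ) (lam w κ : Fin n → ℝ) (w₀ : ℝ), 0 ≤ w₀ → w₀ ≤ δ * D →
        (∀ k, 0 < w k) → (∀ k, 0 ≤ κ k ∧ κ k < 1 / 2) → LocBand δ D Λ lam w w₀ →
        ∃ b : Fin n → ℂ,
          (∫ u in Icc (-1 : ℝ) 1, ‖2 * (Real.sinh (κ₀ * u) : ℂ) -
              ∑ k, b k * (Real.cosh (κ k * u) : ℂ) * cexp (-(I * (lam k : ℂ) * u))‖ ^ 2) +
            ∑ k, ‖b k‖ ^ 2 / w k ≤ (1 + ε) * Phi κ₀ / (2 * Real.pi * θ * D)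

/-! ### G8.6 (T8b) Screening from a NORMALISED mass-aware synthesis — the `m₀`-scaling step of card §14b, in kernel

Helpers are indexed uniformly by `k : Fin n ↦ s k`, a class representative: an ON-LINE class contributes the waveform `e^{−i(τ_k−τ₀)u}`
with weight `m_k`, an OFF-LINE class (representative right of the line; its mirror class rides along in `symVec`) contributes
`cosh(κ_k u)·e^{−i(τ_k−τ₀)u}` with weight `2m_k`.  If the NORMALISED profile `2 sinh(κ₀u)` is synthesised with
`cost + c·Σ|b_k|²/w_k ≤ c·Q` and `m₀·Q < 2`, the target is screened at level `c` (T8a with amplitudes `m₀ b_k`, `m₀ b_k/2`). -/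

open scoped Classical in
/-- Helper WEIGHT of a class representative: its multiplicity if on-line, twice it (the symmetric pair) if off-line. -/
noncomputable def hwt (s : truncIdx N) : ℝ :=
  if (s : ZeroIdx).OffLine then 2 * ((fib s).card : ℝ) else ((fib s).card : ℝ)

/-- Helper weights are positive. -/
theorem hwt_pos (s : truncIdx N) : 0 < hwt s := by
  have h : (0 : ℝ) < (fib s).card := by exact_mod_cast fib_card_pos s
  unfold hwt
  split_ifs <;> linarith

open scoped Classical in
/-- Helper WAVEFORM multiplier: `1` on-line, `cosh(κ_s u)` off-line. -/
noncomputable def hmul (s : truncIdx N) (u : ℝ) : ℂ :=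
  if (s : ZeroIdx).OffLine then (Real.cosh (kap s * u) : ℂ) else 1

/-- Scaled ON-LINE amplitudes `a_k = m₀ b_k`. -/
noncomputable def ampOn (j₀ : truncIdx N) {n : ℕ} (b : Fin n → ℂ) : Fin n → ℂ := fun k ↦ ((fib j₀).card : ℂ) * b k

/-- Scaled OFF-LINE amplitudes `A_k = m₀ b_k / 2`. -/
noncomputable def ampOff (j₀ : truncIdx N) {n : ℕ} (b : Fin n → ℂ) : Fin n → ℂ := fun k ↦ ((fib j₀).card : ℂ) * b k / 2

/-- `ampOn` unfolds to `m₀ · b_k`. -/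
theorem ampOn_apply (j₀ : truncIdx N) {n : ℕ} (b : Fin n → ℂ) (k : Fin n) :
    ampOn j₀ b k = ((fib j₀).card : ℂ) * b k := rfl

/-- `ampOff` unfolds to `m₀ · b_k / 2`. -/
theorem ampOff_apply (j₀ : truncIdx N) {n : ℕ} (b : Fin n → ℂ) (k : Fin n) :
    ampOff j₀ b k = ((fib j₀).card : ℂ) * b k / 2 := rfl

set_option maxHeartbeats 800000 in
/-- **(T8b) Screening from a normalised mass-aware synthesis.**  `j₀` off-line; `s : Fin n → Γ_N` class representatives carrying
pairwise different zeros, the off-line ones RIGHT of the line, none in the target's two classes; if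
`∫_{[−1,1]} |2 sinh(κ₀u) − Σ_k b_k·hmul_k(u)·e^{−i(τ_k−τ₀)u}|² + c·Σ_k |b_k|²/hwt_k ≤ c·Q` and `m₀·Q < 2`, then `𝒦_{[−1,1]}(Γ_N)` has a real
eigenvalue in `(−c, 0)`.  [new; unconditional] -/
theorem synth_negRoot_normalised {j₀ : truncIdx N} (hj : (j₀ : ZeroIdx).OffLine) {n : ℕ}
    {s : Fin n → truncIdx N}
    (hinj : ∀ k l, ((s k : truncIdx N) : ZeroIdx).val = ((s l : truncIdx N) : ZeroIdx).val → k = l)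
    (hright : ∀ k, ((s k : truncIdx N) : ZeroIdx).OffLine → 1 / 2 < ((s k : truncIdx N) : ZeroIdx).val.re)
    (hother : ∀ k, ((s k : truncIdx N) : ZeroIdx).val ≠ (j₀ : ZeroIdx).val ∧
      ((s k : truncIdx N) : ZeroIdx).val ≠ ((tbar j₀ : truncIdx N) : ZeroIdx).val)
    (b : Fin n → ℂ) {c Q : ℝ} (hc : 0 < c)
    (hle : (∫ u in Icc (-1 : ℝ) 1, ‖2 * (Real.sinh (kap j₀ * u) : ℂ) -
        ∑ k, b k * hmul (s k) u * cexp (-(I * ((tau (s k) - tau j₀ : ℝ) : ℂ) * u))‖ ^ 2) +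
        c * ∑ k, ‖b k‖ ^ 2 / hwt (s k) ≤ c * Q)
    (hQ : ((fib j₀).card : ℝ) * Q < 2) :
    ∃ μ ∈ (truncKMat (Icc (-1 : ℝ) 1) N).charpoly.roots, μ.im = 0 ∧ -c < μ.re ∧ μ.re < 0 := by
  classical
  have hcard : (0 : ℝ) < (fib j₀).card := by exact_mod_cast fib_card_pos j₀
  -- the on-line / off-line index sets
  have hon : ∀ i ∈ Finset.univ.filter (fun k ↦ ¬ ((s k : truncIdx N) : ZeroIdx).OffLine),
      ¬ ((s i : truncIdx N) : ZeroIdx).OffLine := fun i hi ↦ (Finset.mem_filter.1 hi).2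
  have hoff : ∀ j ∈ Finset.univ.filter (fun k ↦ ((s k : truncIdx N) : ZeroIdx).OffLine),
      ((s j : truncIdx N) : ZeroIdx).OffLine := fun j hj ↦ (Finset.mem_filter.1 hj).2
  have hinjS : ∀ i ∈ Finset.univ.filter (fun k ↦ ¬ ((s k : truncIdx N) : ZeroIdx).OffLine),
      ∀ l ∈ Finset.univ.filter (fun k ↦ ¬ ((s k : truncIdx N) : ZeroIdx).OffLine),
      ((s i : truncIdx N) : ZeroIdx).val = ((s l : truncIdx N) : ZeroIdx).val → i = l :=
    fun i _ l _ h ↦ hinj i l h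
  have hotherS : ∀ j ∈ Finset.univ.filter (fun k ↦ ((s k : truncIdx N) : ZeroIdx).OffLine),
      ((s j : truncIdx N) : ZeroIdx).val ≠ (j₀ : ZeroIdx).val ∧
        ((s j : truncIdx N) : ZeroIdx).val ≠ ((tbar j₀ : truncIdx N) : ZeroIdx).val := fun j _ ↦ hother j
  have hsep : ∀ j ∈ Finset.univ.filter (fun k ↦ ((s k : truncIdx N) : ZeroIdx).OffLine),
      ∀ l ∈ Finset.univ.filter (fun k ↦ ((s k : truncIdx N) : ZeroIdx).OffLine), j ≠ l →
      ((s j : truncIdx N) : ZeroIdx).val ≠ ((s l : truncIdx N) : ZeroIdx).val ∧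
        ((s j : truncIdx N) : ZeroIdx).val ≠ ((tbar (s l) : truncIdx N) : ZeroIdx).val := by
    intro j hj l hl hjl
    refine ⟨fun h ↦ hjl (hinj j l h), fun h ↦ ?_⟩
    have h1 := hright j (hoff j hj)
    have h2 := hright l (hoff l hl)
    have h3 := congrArg Complex.re h
    rw [re_val_tbar] at h3
    linarith
  -- pointwise waveform identity: the scaled amplitudes reproduce `m₀ ×` the normalised synthesis error
  have key : ∀ x y z : ℂ, 2 * ((fib j₀).card : ℂ) * x - ((fib j₀).card : ℂ) * y - ((fib j₀).card : ℂ) * z =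
      ((fib j₀).card : ℂ) * (2 * x - (z + y)) := by
    intros; ring
  have hpt : ∀ u : ℝ,
      ‖F N (allVec j₀ (Finset.univ.filter (fun k ↦ ¬ ((s k : truncIdx N) : ZeroIdx).OffLine)) s (ampOn j₀ b)
          (Finset.univ.filter (fun k ↦ ((s k : truncIdx N) : ZeroIdx).OffLine)) s (ampOff j₀ b)) u‖ =
        ((fib j₀).card : ℝ) * ‖2 * (Real.sinh (kap j₀ * u) : ℂ) -
          ∑ k, b k * hmul (s k) u * cexp (-(I * ((tau (s k) - tau j₀ : ℝ) : ℂ) * u))‖ := by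
    intro u
    rw [norm_F_allVec _ hon (ampOn j₀ b) _ s (ampOff j₀ b) u,
      ← Finset.sum_filter_add_sum_filter_not Finset.univ (fun k ↦ ((s k : truncIdx N) : ZeroIdx).OffLine)]
    have e1 : ∑ k ∈ Finset.univ.filter (fun k ↦ ((s k : truncIdx N) : ZeroIdx).OffLine),
        b k * hmul (s k) u * cexp (-(I * ((tau (s k) - tau j₀ : ℝ) : ℂ) * u)) =
        ∑ k ∈ Finset.univ.filter (fun k ↦ ((s k : truncIdx N) : ZeroIdx).OffLine),
          b k * (Real.cosh (kap (s k) * u) : ℂ) * cexp (-(I * ((tau (s k) - tau j₀ : ℝ) : ℂ) * u)) :=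
      Finset.sum_congr rfl fun k hk ↦ by rw [hmul, if_pos (hoff k hk)]
    have e2 : ∑ k ∈ Finset.univ.filter (fun k ↦ ¬ ((s k : truncIdx N) : ZeroIdx).OffLine),
        b k * hmul (s k) u * cexp (-(I * ((tau (s k) - tau j₀ : ℝ) : ℂ) * u)) =
        ∑ k ∈ Finset.univ.filter (fun k ↦ ¬ ((s k : truncIdx N) : ZeroIdx).OffLine),
          b k * cexp (-(I * ((tau (s k) - tau j₀ : ℝ) : ℂ) * u)) :=
      Finset.sum_congr rfl fun k hk ↦ by rw [hmul, if_neg (hon k hk), mul_one]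
    have e3 : ∑ j ∈ Finset.univ.filter (fun k ↦ ((s k : truncIdx N) : ZeroIdx).OffLine),
        ampOff j₀ b j * (cexp (-((kap (s j) : ℂ) * u)) + cexp ((kap (s j) : ℂ) * u)) *
          cexp (-(I * ((tau (s j) - tau j₀ : ℝ) : ℂ) * u)) =
        ((fib j₀).card : ℂ) * ∑ k ∈ Finset.univ.filter (fun k ↦ ((s k : truncIdx N) : ZeroIdx).OffLine),
          b k * (Real.cosh (kap (s k) * u) : ℂ) * cexp (-(I * ((tau (s k) - tau j₀ : ℝ) : ℂ) * u)) := by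
      rw [Finset.mul_sum]
      refine Finset.sum_congr rfl fun k _ ↦ ?_
      rw [exp_neg_add_exp_eq_two_cosh, ampOff_apply]
      ring
    have e4 : ∑ i ∈ Finset.univ.filter (fun k ↦ ¬ ((s k : truncIdx N) : ZeroIdx).OffLine),
        ampOn j₀ b i * cexp (-(I * ((tau (s i) - tau j₀ : ℝ) : ℂ) * u)) =
        ((fib j₀).card : ℂ) * ∑ k ∈ Finset.univ.filter (fun k ↦ ¬ ((s k : truncIdx N) : ZeroIdx).OffLine),
          b k * cexp (-(I * ((tau (s k) - tau j₀ : ℝ) : ℂ) * u)) := by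
      rw [Finset.mul_sum]
      refine Finset.sum_congr rfl fun k _ ↦ ?_
      rw [ampOn_apply]
      ring
    rw [e1, e2, e3, e4, key, norm_mul, Complex.norm_natCast]
  -- the cost scales by `m₀²`
  have hint : (∫ u in Icc (-1 : ℝ) 1,
      ‖F N (allVec j₀ (Finset.univ.filter (fun k ↦ ¬ ((s k : truncIdx N) : ZeroIdx).OffLine)) s (ampOn j₀ b)
          (Finset.univ.filter (fun k ↦ ((s k : truncIdx N) : ZeroIdx).OffLine)) s (ampOff j₀ b)) u‖ ^ 2) =
      ((fib j₀).card : ℝ) ^ 2 * ∫ u in Icc (-1 : ℝ) 1, ‖2 * (Real.sinh (kap j₀ * u) : ℂ) -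
          ∑ k, b k * hmul (s k) u * cexp (-(I * ((tau (s k) - tau j₀ : ℝ) : ℂ) * u))‖ ^ 2 := by
    rw [← integral_const_mul]
    congr 1
    ext u
    rw [hpt u]
    ring
  -- the debit scales by `m₀²`
  have hdeb : ∑ i ∈ Finset.univ.filter (fun k ↦ ¬ ((s k : truncIdx N) : ZeroIdx).OffLine),
        ‖ampOn j₀ b i‖ ^ 2 / ((fib (s i)).card : ℝ) +
      ∑ j ∈ Finset.univ.filter (fun k ↦ ((s k : truncIdx N) : ZeroIdx).OffLine),
        2 * ‖ampOff j₀ b j‖ ^ 2 / ((fib (s j)).card : ℝ) =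
      ((fib j₀).card : ℝ) ^ 2 * ∑ k, ‖b k‖ ^ 2 / hwt (s k) := by
    have h1 : ∑ i ∈ Finset.univ.filter (fun k ↦ ¬ ((s k : truncIdx N) : ZeroIdx).OffLine),
        ‖ampOn j₀ b i‖ ^ 2 / ((fib (s i)).card : ℝ) =
        ∑ k ∈ Finset.univ.filter (fun k ↦ ¬ ((s k : truncIdx N) : ZeroIdx).OffLine),
          ((fib j₀).card : ℝ) ^ 2 * (‖b k‖ ^ 2 / hwt (s k)) := by
      refine Finset.sum_congr rfl fun k hk ↦ ?_
      rw [hwt, if_neg (hon k hk), ampOn_apply, norm_mul, Complex.norm_natCast]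
      ring
    have h2 : ∑ j ∈ Finset.univ.filter (fun k ↦ ((s k : truncIdx N) : ZeroIdx).OffLine),
        2 * ‖ampOff j₀ b j‖ ^ 2 / ((fib (s j)).card : ℝ) =
        ∑ k ∈ Finset.univ.filter (fun k ↦ ((s k : truncIdx N) : ZeroIdx).OffLine),
          ((fib j₀).card : ℝ) ^ 2 * (‖b k‖ ^ 2 / hwt (s k)) := by
      refine Finset.sum_congr rfl fun k hk ↦ ?_
      have hm : (0 : ℝ) < (fib (s k)).card := by exact_mod_cast fib_card_pos (s k)
      rw [hwt, if_pos (hoff k hk), ampOff_apply, norm_div, norm_mul, Complex.norm_natCast, Complex.norm_two]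
      ring
    have hs := Finset.sum_filter_add_sum_filter_not Finset.univ (fun k ↦ ((s k : truncIdx N) : ZeroIdx).OffLine)
      (fun k ↦ ((fib j₀).card : ℝ) ^ 2 * (‖b k‖ ^ 2 / hwt (s k)))
    rw [h1, h2, Finset.mul_sum]
    linarith [hs]
  refine synth_negRoot_all hj _ hon hinjS (ampOn j₀ b) _ hoff hotherS hsep (ampOff j₀ b) hc ?_
  rw [hint, hdeb]
  set X := ∫ u in Icc (-1 : ℝ) 1, ‖2 * (Real.sinh (kap j₀ * u) : ℂ) -
      ∑ k, b k * hmul (s k) u * cexp (-(I * ((tau (s k) - tau j₀ : ℝ) : ℂ) * u))‖ ^ 2 with hX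
  set Y := ∑ k, ‖b k‖ ^ 2 / hwt (s k) with hY
  calc ((fib j₀).card : ℝ) ^ 2 * X + c * (((fib j₀).card : ℝ) ^ 2 * Y)
      = ((fib j₀).card : ℝ) ^ 2 * (X + c * Y) := by ring
    _ ≤ ((fib j₀).card : ℝ) ^ 2 * (c * Q) := mul_le_mul_of_nonneg_left hle (sq_nonneg _)
    _ = (c * (fib j₀).card) * (((fib j₀).card : ℝ) * Q) := by ring
    _ < (c * (fib j₀).card) * 2 := mul_lt_mul_of_pos_left hQ (mul_pos hc hcard)
    _ = 2 * c * (fib j₀).card := by ring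

/-! ### G8.7 (T8c) OFF-LINE SCREENING AT LEVEL ONE from MASS-AWARE SAMPLING and a HELPER BAND — card §14b/14h in kernel

`HelperBand T₀ δ` is the configuration-level COUNTING input (ζ-side; dischargeable from Riemann–von Mangoldt with an explicit `S(T)` bound
plus slot combinatorics — g9 K-comb/K-count): above `T₀`, around every off-line zero `ρ` right of the line and for every window
`Λ ≤ Im ρ/8π` (density drift `≤ 2Λ/(π Im ρ)` per length-4 interval, no zero-free hole), eventually in `N` the class representatives of `Γ_N`
in the window (one per on-line class, one RIGHT representative per off-line mirror pair, the target's own pair excluded and counted as a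
virtual atom of mass `2m₀ ≤ δ·D`) satisfy `LocBand δ D(Im ρ) Λ`, `D(τ) = log(τ/2π)/2π`.
T8c: `MassAwareSampling δ θ ∧ (∀ κ₀ ∈ (0,½), δ·Φ(κ₀) < 8πθ) ∧ HelperBand T₀ δ ∧ T₀ ≥ 2π·e^{2π} ⟹ OffLineScreenedAboveAt T₀ 1`. -/

/-- Zero-ordinate DENSITY at height `τ`: `D(τ) = (1/2π)·log(τ/2π)`. -/
noncomputable def zdens (τ : ℝ) : ℝ := Real.log (τ / (2 * Real.pi)) / (2 * Real.pi)

/-- `e^{2π D(τ)} = τ/2π`. -/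
theorem exp_two_pi_mul_zdens {τ : ℝ} (hτ : 0 < τ) : Real.exp (2 * Real.pi * zdens τ) = τ / (2 * Real.pi) := by
  have hπ : (2 * Real.pi) ≠ 0 := by positivity
  rw [zdens, mul_div_cancel₀ _ hπ, Real.exp_log (by positivity)]

open scoped Classical in
/-- Helper DECAY parameter: `κ_s` off-line, `0` on-line (so that `hmul_s(u) = cosh(hkap_s·u)`). -/
noncomputable def hkap (s : truncIdx N) : ℝ := if (s : ZeroIdx).OffLine then kap s else 0

/-- The helper multiplier is `cosh(hkap s · u)` (`hkap = 0` on the line). -/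
theorem hmul_eq (s : truncIdx N) (u : ℝ) : hmul s u = (Real.cosh (hkap s * u) : ℂ) := by
  unfold hmul hkap
  split_ifs <;> simp

/-- For a RIGHT representative, `0 ≤ hkap s < ½`. -/
theorem hkap_range (s : truncIdx N) (hright : (s : ZeroIdx).OffLine → 1 / 2 < (s : ZeroIdx).val.re) :
    0 ≤ hkap s ∧ hkap s < 1 / 2 := by
  unfold hkap
  split_ifs with h
  · have h1 := hright h
    have h2 := ((s : truncIdx N) : ZeroIdx).re_pos_and_lt_one.2
    rw [kap]
    constructor <;> linarith
  · norm_num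

/-- **HELPER BAND above `T₀` at relative width `δ`** (typed COUNTING hypothesis; ζ-side, no analysis): see the section docstring.
[new; typed hypothesis — to be discharged from `zetaZeroCount` facts (Riemann–von Mangoldt + explicit `S(T)`) and slot combinatorics] -/
def HelperBand (T₀ δ : ℝ) : Prop :=
  ∀ ρ ∈ ZetaZeros.riemannZetaNontrivialZeros, 1 / 2 < ρ.re → T₀ < ρ.im → ∀ Λ : ℝ, 0 < Λ → Λ ≤ ρ.im / (8 * Real.pi) →
    ∃ N₀ : ℕ, ∀ N : ℕ, N₀ ≤ N → ∃ j₀ : truncIdx N, (j₀ : ZeroIdx).val = ρ ∧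
      ∃ (n : ℕ) (s : Fin n → truncIdx N),
        (∀ k l, ((s k : truncIdx N) : ZeroIdx).val = ((s l : truncIdx N) : ZeroIdx).val → k = l) ∧
        (∀ k, ((s k : truncIdx N) : ZeroIdx).OffLine → 1 / 2 < ((s k : truncIdx N) : ZeroIdx).val.re) ∧
        (∀ k, ((s k : truncIdx N) : ZeroIdx).val ≠ (j₀ : ZeroIdx).val ∧
          ((s k : truncIdx N) : ZeroIdx).val ≠ ((tbar j₀ : truncIdx N) : ZeroIdx).val) ∧
        2 * ((fib j₀).card : ℝ) ≤ δ * zdens ρ.im ∧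
        LocBand δ (zdens ρ.im) Λ (fun k ↦ tau (s k) - tau j₀) (fun k ↦ hwt (s k)) (2 * ((fib j₀).card : ℝ))

set_option maxHeartbeats 800000 in
/-- **(T8c) OFF-LINE SCREENING ABOVE `T₀` AT LEVEL ONE from MASS-AWARE SAMPLING + HELPER BAND.**  If the ζ-free sampling lemma holds at
`(δ, θ)` with `δ·Φ(κ₀) < 8πθ` for every decay `κ₀ ∈ (0, ½)`, and the zeros above `T₀ ≥ 2π·e^{2π}` obey the helper band at width `δ`, then
every off-line zero right of the line above `T₀` is screened at level `1`: `OffLineScreenedAboveAt T₀ 1` — hence rows X-7₁ / X-7₁/PT with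
these hypotheses in place of the screening hypothesis.  [new; unconditional reduction] -/
theorem offLineScreenedAboveAt_of_helperBand {T₀ δ θ : ℝ} (hθ : 0 < θ) (hS : MassAwareSampling δ θ)
    (hcrit : ∀ κ₀ : ℝ, 0 < κ₀ → κ₀ < 1 / 2 → δ * Phi κ₀ < 8 * Real.pi * θ)
    (hH : HelperBand T₀ δ) (hT : 2 * Real.pi * Real.exp (2 * Real.pi) ≤ T₀) : OffLineScreenedAboveAt T₀ 1 := by
  intro ρ hρ hre hτ
  have hre1 : ρ.re < 1 := (mem_riemannZetaNontrivialZeros_iff_holds.1 hρ).2.2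
  set κ₀ : ℝ := ρ.re - 1 / 2 with hκ₀def
  have hκ₀ : 0 < κ₀ := by rw [hκ₀def]; linarith
  have hκ₀' : κ₀ < 1 / 2 := by rw [hκ₀def]; linarith
  set D : ℝ := zdens ρ.im with hDdef
  have hπ : 0 < 2 * Real.pi := by positivity
  have him : 0 < ρ.im := by
    have : 0 < 2 * Real.pi * Real.exp (2 * Real.pi) := by positivity
    linarith
  have hD : 1 ≤ D := by
    have h0 : 2 * Real.pi * Real.exp (2 * Real.pi) < ρ.im := lt_of_le_of_lt hT hτ
    have h1 : Real.exp (2 * Real.pi) ≤ ρ.im / (2 * Real.pi) := by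
      rw [le_div_iff₀ hπ]; linarith
    have h2 : 2 * Real.pi ≤ Real.log (ρ.im / (2 * Real.pi)) := by
      have := Real.log_le_log (Real.exp_pos _) h1
      rwa [Real.log_exp] at this
    rw [hDdef, zdens, le_div_iff₀ hπ]; linarith
  have hDpos : 0 < D := by linarith
  -- the relative slack ε
  obtain ⟨ε, hε, hmain⟩ : ∃ ε : ℝ, 0 < ε ∧ (1 + ε) * (δ * Phi κ₀) < 8 * Real.pi * θ := by
    have hlt := hcrit κ₀ hκ₀ hκ₀'
    obtain ⟨X, hXdef⟩ : ∃ X : ℝ, X = δ * Phi κ₀ := ⟨_, rfl⟩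
    rw [← hXdef] at hlt ⊢
    by_cases hpos : 0 < X
    · refine ⟨(8 * Real.pi * θ - X) / (2 * X), div_pos (by linarith) (by linarith), ?_⟩
      have hX0 : X ≠ 0 := hpos.ne'
      have hid : (1 + (8 * Real.pi * θ - X) / (2 * X)) * X = (X + 8 * Real.pi * θ) / 2 := by
        field_simp
        ring
      rw [hid]
      linarith
    · have hpos' : X ≤ 0 := not_lt.mp hpos
      have h8 : 0 < 8 * Real.pi * θ := by positivity
      exact ⟨1, one_pos, by linarith⟩
  -- sampling lemma (its window is within the cap the zeros supply) and helper band
  obtain ⟨Λ, hΛ, hΛcap, hsyn⟩ := hS ε hε κ₀ hκ₀ hκ₀' D hD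
  have hcap : Λ ≤ ρ.im / (8 * Real.pi) := by
    rw [hDdef, exp_two_pi_mul_zdens him] at hΛcap
    have : ρ.im / (2 * Real.pi) / 4 = ρ.im / (8 * Real.pi) := by ring
    linarith [this]
  obtain ⟨N₀, hN₀⟩ := hH ρ hρ hre hτ Λ hΛ hcap
  refine ⟨N₀, fun N hN ↦ ?_⟩
  obtain ⟨j₀, hj₀, n, s, hinj, hright, hother, hm₀, hband⟩ := hN₀ N hN
  have hj : (j₀ : ZeroIdx).OffLine := by
    show (j₀ : ZeroIdx).val.re ≠ 1 / 2
    rw [hj₀]; exact ne_of_gt hre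
  have hkap0 : kap j₀ = κ₀ := by rw [hκ₀def, kap, hj₀]
  have hw : ∀ k, 0 < hwt (s k) := fun k ↦ hwt_pos (s k)
  have hk : ∀ k, 0 ≤ hkap (s k) ∧ hkap (s k) < 1 / 2 := fun k ↦ hkap_range (s k) (hright k)
  have hw₀ : (0 : ℝ) ≤ 2 * ((fib j₀).card : ℝ) := by positivity
  obtain ⟨b, hb⟩ := hsyn n (fun k ↦ tau (s k) - tau j₀) (fun k ↦ hwt (s k)) (fun k ↦ hkap (s k))
    (2 * ((fib j₀).card : ℝ)) hw₀ hm₀ hw hk hband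
  -- rewrite the lemma's output in the form of T8b (ridge level 1)
  simp_rw [← hmul_eq] at hb
  have hle : (∫ u in Icc (-1 : ℝ) 1, ‖2 * (Real.sinh (kap j₀ * u) : ℂ) -
      ∑ k, b k * hmul (s k) u * cexp (-(I * ((tau (s k) - tau j₀ : ℝ) : ℂ) * u))‖ ^ 2) +
      1 * ∑ k, ‖b k‖ ^ 2 / hwt (s k) ≤ 1 * ((1 + ε) * Phi κ₀ / (2 * Real.pi * θ * D)) := by
    rw [hkap0, one_mul, one_mul]; exact hb
  -- the budget inequality m₀·Q < 2
  have hcard : (0 : ℝ) < (fib j₀).card := by exact_mod_cast fib_card_pos j₀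
  have hQ : ((fib j₀).card : ℝ) * ((1 + ε) * Phi κ₀ / (2 * Real.pi * θ * D)) < 2 := by
    have hden : 0 < 2 * Real.pi * θ * D := by positivity
    by_cases hΦ : 0 ≤ Phi κ₀
    · have hQnn : 0 ≤ (1 + ε) * Phi κ₀ / (2 * Real.pi * θ * D) := by positivity
      calc ((fib j₀).card : ℝ) * ((1 + ε) * Phi κ₀ / (2 * Real.pi * θ * D))
          ≤ (δ * D / 2) * ((1 + ε) * Phi κ₀ / (2 * Real.pi * θ * D)) :=
            mul_le_mul_of_nonneg_right (by linarith) hQnn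
        _ = ((1 + ε) * (δ * Phi κ₀)) / (4 * Real.pi * θ) := by
            field_simp
            ring
        _ < 2 := by
            rw [div_lt_iff₀ (by positivity)]
            linarith
    · have hΦ' : Phi κ₀ < 0 := not_le.mp hΦ
      have h1 : (1 + ε) * Phi κ₀ / (2 * Real.pi * θ * D) < 0 :=
        div_neg_of_neg_of_pos (by nlinarith) hden
      nlinarith
  exact synth_negRoot_normalised hj hinj hright hother b one_pos hle hQ

/-- Row **X-7♮** (g8, T8c form): `MassAwareSampling δ θ ∧ (δ·Φ < 8πθ on (0,½)) ∧ HelperBand T₀ δ ∧ T₀ ≥ 2π e^{2π}` ⟹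
`RH ⟺ RH(T₀) ∧ B′₁([−1,1])` — the row's residual hypotheses are ONE ζ-free analytic conjecture and ONE counting statement.
[new; conditional bookkeeping] -/
theorem rh_iff_rhUpTo_and_boundedAwayAt_of_sampling {T₀ δ θ : ℝ} (hθ : 0 < θ) (hS : MassAwareSampling δ θ)
    (hcrit : ∀ κ₀ : ℝ, 0 < κ₀ → κ₀ < 1 / 2 → δ * Phi κ₀ < 8 * Real.pi * θ)
    (hH : HelperBand T₀ δ) (hT : 2 * Real.pi * Real.exp (2 * Real.pi) ≤ T₀) :
    _root_.RiemannHypothesis ↔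
      RiemannHypothesisUpTo T₀ ∧ TruncNegEigenvalueBoundedAwayAt (Icc (-1 : ℝ) 1) 1 :=
  rh_iff_rhUpTo_and_boundedAwayAt (offLineScreenedAboveAt_of_helperBand hθ hS hcrit hH hT)

end Summit.RiemannHypothesis.RiemannHypothesis.Theorems.Splittings.BombieriTruncMassAware
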